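import Mathlib.Analysis.Matrix.Normed
import Literature.GroupTheory.QuasirandomGroups.ProductMixing
import Literature.RepresentationTheory.FiniteGroups.FourierInversionIdentity
import Literature.RepresentationTheory.FiniteGroups.UnitaryWedderburn
import Literature.Combinatorics.Additive.TPPGroupAlgebra
import Literature.MathematicalPhysics.QuantumLattice.TracePowerInequalities
import HarnessLib

/-!
# Proof of Gowers 2008, Theorem 3.3 (product mixing in quasirandom groups)

Topic `Literature/GroupTheory/QuasirandomGroups`.  DISCHARGE of the named fact
`Literature.GroupTheory.QuasirandomGroups.Gowers2008_thm_3_3` (`ProductMixing.lean`):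
`Gowers2008_thm_3_3_holds`, through the quantitative count estimate `product_mixing_count`
(`N ≥ |A||B||C|/|G| − (|G||A||B||C|/k)^{1/2}` for the number `N` of pairs `(a,b) ∈ A × B` with
`ab ∈ C`).  Theorems only; no definition, no named fact, no instance, no notation.

Proof (Gowers' Fourier-analytic argument, in the tree's unitary-Wedderburn currency — the route of
`Literature.Barriers.MatrixMultiplication.BCGPU2023_thm32_holds`, whose three generic matrix
lemmas are re-proved here as private helpers so that `GroupTheory` does not import `Barriers`):
with `φ : ℂ[G] ≃ₐ ∏ᵢ ℂ^{dᵢ×dᵢ}` unitary on `G` (`exists_unitary_algEquiv_pi_matrix`),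
`a = φ 𝟙_A`, `b = φ 𝟙_B`, `c = φ 𝟙_{C⁻¹} = (φ 𝟙_C)ᴴ`:  Fourier inversion at `1`
(`card_mul_coeff_one_eq_sum_trace`) gives `|G|·N = ∑ᵢ dᵢ tr(aᵢbᵢcᵢ)`; blocks of dimension `< k`
are trivial by hypothesis (applied to the tree's `blockRep φ i`), so they contribute
`dᵢ²|A||B||C| ≥ 0`, and the trivial block (`exists_trivial_block`) contributes `|A||B||C|`; blocks
of dimension `≥ k` contribute at most `(|G||A|/k)^{1/2} (|G||B|)^{1/2} (|G||C|)^{1/2}` by the trace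
Cauchy–Schwarz inequality (`Literature.MathematicalPhysics.QuantumLattice.norm_trace_mul_le_sqrt_mul_sqrt`),
`dᵢ‖aᵢ‖² ≤ ∑ⱼ dⱼ‖aⱼ‖² = |G||A|` (Parseval) and Cauchy–Schwarz over `i`
(`Real.sum_sqrt_mul_sqrt_le`).  Both printed clauses follow from the count estimate by squaring.

Source: W. T. Gowers, *Quasirandom groups*, Combin. Probab. Comput. 17 (2008), Thm. 3.3 and its
proof (held text `paper:arxiv-0710.3877`, p0005–p0006) [Gowers2008].  Honest framing: a classical
theorem; `VP ≠ VNP` is NOT proved and nothing here is progress on it.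
-/

noncomputable section

open scoped BigOperators Matrix ComplexOrder

namespace Literature.GroupTheory.QuasirandomGroups

open Literature.RepresentationTheory.FiniteGroups Literature.Combinatorics.Additive
open Literature.MathematicalPhysics.QuantumLattice (trace_mul_conjTranspose_self_eq
  trace_conjTranspose_mul_self_re norm_trace_mul_le_sqrt_mul_sqrt)

/-! ## Matrix lemmas (the generic half of the BCGPU route, re-proved locally) -/

section MatrixBounds

variable {m : Type*} [Fintype m]

/-- `0 ≤ Re tr(Xᴴ X)` (the squared Frobenius norm). [folklore] -/
private theorem re_trace_conjTranspose_mul_self_nonneg (X : Matrix m m ℂ) : 0 ≤ (Xᴴ * X).trace.re := by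
  rw [trace_conjTranspose_mul_self_re]
  exact Finset.sum_nonneg fun _ _ => Finset.sum_nonneg fun _ _ => by positivity

open scoped Matrix.Norms.Frobenius in
/-- Submultiplicativity of the Frobenius norm in trace form:
`Re tr((BC)ᴴ(BC)) ≤ Re tr(Bᴴ B) · Re tr(Cᴴ C)`. [folklore] -/
private theorem re_trace_conjTranspose_mul_self_mul_le (B C : Matrix m m ℂ) :
    ((B * C)ᴴ * (B * C)).trace.re ≤ (Bᴴ * B).trace.re * (Cᴴ * C).trace.re := by
  have hsq : ∀ X : Matrix m m ℂ, ‖X‖ ^ 2 = (Xᴴ * X).trace.re := fun X => by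
    rw [trace_conjTranspose_mul_self_re, Matrix.frobenius_norm_def, ← Real.sqrt_eq_rpow,
      Real.sq_sqrt (Finset.sum_nonneg fun _ _ => Finset.sum_nonneg fun _ _ => by positivity)]
    simp
  rw [← hsq, ← hsq, ← hsq, ← mul_pow]
  exact pow_le_pow_left₀ (norm_nonneg _) (Matrix.frobenius_norm_mul B C) 2

/-- `|tr(A B C)| ≤ ‖A‖_F ‖B‖_F ‖C‖_F` with `‖X‖_F = (Re tr Xᴴ X)^{1/2}`. [folklore] -/
private theorem norm_trace_mul_mul_le (A B C : Matrix m m ℂ) :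
    ‖(A * B * C).trace‖ ≤ Real.sqrt ((Aᴴ * A).trace.re) *
      (Real.sqrt ((Bᴴ * B).trace.re) * Real.sqrt ((Cᴴ * C).trace.re)) := by
  have h := norm_trace_mul_le_sqrt_mul_sqrt A (B * C)
  rw [← Matrix.mul_assoc, Matrix.trace_mul_comm A Aᴴ] at h
  refine h.trans (mul_le_mul_of_nonneg_left ?_ (Real.sqrt_nonneg _))
  rw [← Real.sqrt_mul (re_trace_conjTranspose_mul_self_nonneg B)]
  exact Real.sqrt_le_sqrt (re_trace_conjTranspose_mul_self_mul_le B C)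

end MatrixBounds

/-! ## Group-algebra lemmas -/

section GroupAlgebra

variable {G : Type} [Group G]

/-- `(𝟙_A 𝟙_B 𝟙_{C⁻¹})(1)` is the number of pairs `(a,b) ∈ A × B` with `ab ∈ C`. [folklore] -/
private theorem coeff_one_indicator_mul_mul_inv [DecidableEq G] (A B C : Finset G) :
    (indicatorElem ℂ A * indicatorElem ℂ B * indicatorElemInv ℂ C).coeff 1 =
      (((A ×ˢ B).filter fun p => p.1 * p.2 ∈ C).card : ℂ) := by
  have e1 := sum_single_mul_sum_single (k := ℂ) A B id id
  have e2 := sum_single_mul_sum_single (k := ℂ) (A ×ˢ B) C (fun p : G × G => p.1 * p.2)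
    (fun c : G => c⁻¹)
  have e3 := coeff_one_sum_single (k := ℂ) ((A ×ˢ B) ×ˢ C)
    (fun q : (G × G) × G => q.1.1 * q.1.2 * q.2⁻¹)
  simp only [id] at e1 e2 e3
  rw [indicatorElem_def, indicatorElem_def, indicatorElemInv_def, e1, e2, e3]
  congr 1
  -- `((a,b),c) ↦ (a,b)` is a bijection from `{abc⁻¹ = 1}` onto `{ab ∈ C}`
  refine Finset.card_bij (fun (q : (G × G) × G) _ => q.1) ?_ ?_ ?_
  · intro q hq
    rw [Finset.mem_filter] at hq ⊢
    obtain ⟨hq1, hq2⟩ := hq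
    rw [Finset.mem_product] at hq1
    refine ⟨hq1.1, ?_⟩
    have : q.1.1 * q.1.2 = q.2 := by
      rw [mul_inv_eq_one] at hq2; exact hq2
    rw [this]; exact hq1.2
  · intro q hq q' hq' heq
    rw [Finset.mem_filter] at hq hq'
    have h2 : q.2 = q.1.1 * q.1.2 := by
      have := hq.2; rw [mul_inv_eq_one] at this; exact this.symm
    have h2' : q'.2 = q'.1.1 * q'.1.2 := by
      have := hq'.2; rw [mul_inv_eq_one] at this; exact this.symm
    exact Prod.ext heq (by rw [h2, h2', heq])
  · intro p hp
    rw [Finset.mem_filter] at hp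
    refine ⟨(p, p.1 * p.2), ?_, rfl⟩
    rw [Finset.mem_filter, Finset.mem_product]
    exact ⟨⟨hp.1, hp.2⟩, by rw [mul_inv_eq_one]⟩

/-- `(𝟙_{A⁻¹} 𝟙_A)(1) = |A|`. [folklore] -/
private theorem coeff_one_indicatorInv_mul [DecidableEq G] (A : Finset G) :
    (indicatorElemInv ℂ A * indicatorElem ℂ A).coeff 1 = (A.card : ℂ) := by
  have e1 := sum_single_mul_sum_single (k := ℂ) A A (fun a : G => a⁻¹) id
  have e2 := coeff_one_sum_single (k := ℂ) (A ×ˢ A) (fun p : G × G => p.1⁻¹ * p.2)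
  simp only [id] at e1 e2
  rw [indicatorElem_def, indicatorElemInv_def, e1, e2]
  congr 1
  simp only [inv_mul_eq_one]
  rw [show ((A ×ˢ A).filter fun p : G × G => p.1 = p.2) = A.diag from by
    ext p
    simp only [Finset.mem_diag, Finset.mem_filter, Finset.mem_product]
    constructor
    · rintro ⟨⟨h1, -⟩, h3⟩; exact ⟨h1, h3⟩
    · rintro ⟨h1, h3⟩; exact ⟨⟨h1, h3 ▸ h1⟩, h3⟩]
  exact Finset.diag_card A

variable {r : ℕ} {d : Fin r → ℕ} (φ : MonoidAlgebra ℂ G ≃ₐ[ℂ] BlockAlgebraC d)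

/-- Under a unitary decomposition, `φ(𝟙_{X⁻¹})ᵢ = φ(𝟙_X)ᵢᴴ`. [folklore] -/
private theorem algEquiv_indicatorElemInv_eq_conjTranspose
    (hφ : ∀ (g : G) (i : Fin r),
      (φ (MonoidAlgebra.single g 1) i)ᴴ * φ (MonoidAlgebra.single g 1) i = 1)
    (X : Finset G) (i : Fin r) : φ (indicatorElemInv ℂ X) i = (φ (indicatorElem ℂ X) i)ᴴ := by
  rw [indicatorElemInv_def, indicatorElem_def, map_sum, map_sum, Finset.sum_apply,
    Finset.sum_apply, Matrix.conjTranspose_sum]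
  exact Finset.sum_congr rfl fun g _ => algEquiv_single_inv_eq_conjTranspose φ hφ g i

/-- **Parseval for one set**: `∑ᵢ dᵢ ‖φ(𝟙_X)ᵢ‖²_F = |G|·|X|`. [folklore] -/
private theorem parseval_indicator [Fintype G] [DecidableEq G]
    (hφ : ∀ (g : G) (i : Fin r),
      (φ (MonoidAlgebra.single g 1) i)ᴴ * φ (MonoidAlgebra.single g 1) i = 1)
    (X : Finset G) :
    ∑ i, (d i : ℝ) * ((φ (indicatorElem ℂ X) i)ᴴ * φ (indicatorElem ℂ X) i).trace.re =
      (Fintype.card G : ℝ) * X.card := by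
  have h := card_mul_coeff_one_eq_sum_trace φ (indicatorElemInv ℂ X * indicatorElem ℂ X)
  rw [coeff_one_indicatorInv_mul] at h
  have h' := congrArg Complex.re h
  rw [Complex.re_sum] at h'
  have lhs : ((Fintype.card G : ℂ) * (X.card : ℂ)).re = (Fintype.card G : ℝ) * X.card := by
    norm_cast
  rw [lhs] at h'
  rw [h']
  refine Finset.sum_congr rfl fun i _ => ?_
  rw [map_mul, Pi.mul_apply, algEquiv_indicatorElemInv_eq_conjTranspose φ hφ,
    Matrix.trace_mul_comm, ← Matrix.trace_mul_comm]
  simp [Complex.mul_re]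

/-- A block on which `G` acts trivially sees `𝟙_X` as the scalar `|X|`. [folklore] -/
private theorem indicator_block_of_trivial {i : Fin r} (hi : ∀ g : G, φ (MonoidAlgebra.single g 1) i = 1)
    (X : Finset G) : φ (indicatorElem ℂ X) i = (X.card : ℂ) • (1 : Matrix _ _ ℂ) := by
  rw [indicatorElem_def, map_sum, Finset.sum_apply]
  simp only [hi, Finset.sum_const, Nat.cast_smul_eq_nsmul]

/-- … and `𝟙_{X⁻¹}` as well. [folklore] -/
private theorem indicatorInv_block_of_trivial {i : Fin r}
    (hi : ∀ g : G, φ (MonoidAlgebra.single g 1) i = 1)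
    (X : Finset G) : φ (indicatorElemInv ℂ X) i = (X.card : ℂ) • (1 : Matrix _ _ ℂ) := by
  rw [indicatorElemInv_def, map_sum, Finset.sum_apply]
  simp only [hi, Finset.sum_const, Nat.cast_smul_eq_nsmul]

end GroupAlgebra

/-! ## The count estimate -/

/-- **Gowers' count estimate**: if every IRREDUCIBLE representation of `G` of dimension `< k`
(`k ≥ 1`) is trivial (equivalently, by Maschke, every representation of dimension `< k`; the
irreducible form is the weaker hypothesis and is what the proof uses, on the Wedderburn blocks),
then for all `A, B, C ⊆ G` the number `N` of pairs `(a,b) ∈ A × B` with `ab ∈ C` satisfies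
`N ≥ |A||B||C|/|G| − (|G||A||B||C|/k)^{1/2}`. [cite: Gowers2008, Thm. 3.3 (proof)] -/
theorem product_mixing_count (G : Type) [Group G] [Fintype G] [DecidableEq G] (k : ℕ)
    (hk : 1 ≤ k)
    (hq : ∀ (V : Type) [AddCommGroup V] [Module ℂ V] [FiniteDimensional ℂ V]
        (ρ : Representation ℂ G V), ρ.IsIrreducible → Module.finrank ℂ V < k →
        ∀ g : G, ρ g = LinearMap.id)
    (A B C : Finset G) :
    (A.card : ℝ) * B.card * C.card / Fintype.card G -
        Real.sqrt (Fintype.card G * ((A.card : ℝ) * B.card * C.card) / k) ≤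
      (((A ×ˢ B).filter fun p => p.1 * p.2 ∈ C).card : ℝ) := by
  classical
  set P : ℝ := (A.card : ℝ) * B.card * C.card with hP
  set N : ℕ := ((A ×ˢ B).filter fun p => p.1 * p.2 ∈ C).card with hN
  set cG : ℝ := (Fintype.card G : ℝ) with hcG
  have hGpos : (0 : ℝ) < cG := by rw [hcG]; exact_mod_cast Fintype.card_pos
  have hP0 : 0 ≤ P := by rw [hP]; positivity
  have hA : (A.card : ℝ) ≤ cG := by rw [hcG]; exact_mod_cast Finset.card_le_univ A
  have hB : (B.card : ℝ) ≤ cG := by rw [hcG]; exact_mod_cast Finset.card_le_univ B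
  have hC : (C.card : ℝ) ≤ cG := by rw [hcG]; exact_mod_cast Finset.card_le_univ C
  have hPle : P ≤ cG ^ 3 := by
    rw [hP]
    calc (A.card : ℝ) * B.card * C.card ≤ cG * cG * cG :=
          mul_le_mul (mul_le_mul hA hB (Nat.cast_nonneg _) hGpos.le) hC (Nat.cast_nonneg _)
            (by positivity)
      _ = cG ^ 3 := by ring
  -- the case `k = 1`: the bound is non-positive
  by_cases hk1 : k = 1
  · subst hk1
    have hle : P / cG ≤ Real.sqrt (cG * P / (1 : ℕ)) := by
      rw [Nat.cast_one, div_one]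
      apply Real.le_sqrt_of_sq_le
      rw [div_pow, div_le_iff₀ (by positivity)]
      nlinarith
    have : (0 : ℝ) ≤ N := Nat.cast_nonneg _
    linarith
  have hk2 : 2 ≤ k := by omega
  -- a unitary Wedderburn decomposition and its trivial block
  obtain ⟨r, d, hd, φ, hφ⟩ := exists_unitary_algEquiv_pi_matrix G
  obtain ⟨i₀, hdi₀, hφi₀⟩ := exists_trivial_block φ
  set a : ∀ i : Fin r, Matrix (Fin (d i)) (Fin (d i)) ℂ := fun i => φ (indicatorElem ℂ A) i with ha
  set b : ∀ i : Fin r, Matrix (Fin (d i)) (Fin (d i)) ℂ := fun i => φ (indicatorElem ℂ B) i with hb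
  set c : ∀ i : Fin r, Matrix (Fin (d i)) (Fin (d i)) ℂ := fun i => φ (indicatorElemInv ℂ C) i
    with hc
  have hcC : ∀ i, c i = (φ (indicatorElem ℂ C) i)ᴴ := fun i =>
    algEquiv_indicatorElemInv_eq_conjTranspose φ hφ C i
  -- (1) Fourier inversion at `1`: `|G| N = ∑ dᵢ Re tr(aᵢ bᵢ cᵢ)`
  have h1 : cG * N = ∑ i, (d i : ℝ) * (a i * b i * c i).trace.re := by
    have h := card_mul_coeff_one_eq_sum_trace φ
      (indicatorElem ℂ A * indicatorElem ℂ B * indicatorElemInv ℂ C)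
    rw [coeff_one_indicator_mul_mul_inv] at h
    simp only [map_mul, Pi.mul_apply] at h
    have h' := congrArg Complex.re h
    rw [Complex.re_sum] at h'
    have lhs : ((Fintype.card G : ℂ) * (N : ℂ)).re = cG * N := by rw [hcG]; norm_cast
    rw [← hN, lhs] at h'
    rw [h']
    refine Finset.sum_congr rfl fun i _ => ?_
    simp [ha, hb, hc, Complex.mul_re]
  -- (2) Parseval
  have h2A : ∑ i, (d i : ℝ) * ((a i)ᴴ * a i).trace.re = cG * A.card := parseval_indicator φ hφ A
  have h2B : ∑ i, (d i : ℝ) * ((b i)ᴴ * b i).trace.re = cG * B.card := parseval_indicator φ hφ B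
  have h2C : ∑ i, (d i : ℝ) * ((c i)ᴴ * c i).trace.re = cG * C.card := by
    have h := parseval_indicator φ hφ C
    rw [← h]
    refine Finset.sum_congr rfl fun i _ => ?_
    rw [hcC, Matrix.conjTranspose_conjTranspose, Matrix.trace_mul_comm]
  -- (3) blocks of dimension `< k` are trivial and contribute `dᵢ² P ≥ 0`; the block `i₀` gives `P`
  have htriv : ∀ i, d i < k → ∀ g : G, φ (MonoidAlgebra.single g 1) i = 1 := by
    intro i hi g
    have hfin : Module.finrank ℂ (Fin (d i) → ℂ) < k := by
      rw [Module.finrank_fin_fun]; exact hi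
    have h := hq (Fin (d i) → ℂ) (blockRep φ i) (isIrreducible_blockRep φ i) hfin g
    rw [blockRep_apply, ← Matrix.toLin'_one] at h
    exact Matrix.toLin'.injective h
  have hsmall : ∀ i, d i < k → (d i : ℝ) * (a i * b i * c i).trace.re = (d i : ℝ) ^ 2 * P := by
    intro i hi
    simp only [ha, hb, hc, indicator_block_of_trivial φ (htriv i hi),
      indicatorInv_block_of_trivial φ (htriv i hi), Matrix.smul_mul, Matrix.mul_smul,
      Matrix.one_mul, smul_smul, Matrix.trace_smul, Matrix.trace_one, Fintype.card_fin, hP]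
    simp
    ring
  have h3 : P ≤ ∑ i ∈ Finset.univ.filter (fun i => d i < k),
      (d i : ℝ) * (a i * b i * c i).trace.re := by
    have hi₀k : d i₀ < k := by rw [hdi₀]; omega
    have hmem : i₀ ∈ Finset.univ.filter (fun i => d i < k) :=
      Finset.mem_filter.2 ⟨Finset.mem_univ _, hi₀k⟩
    calc P = (d i₀ : ℝ) ^ 2 * P := by rw [hdi₀]; simp
      _ = (d i₀ : ℝ) * (a i₀ * b i₀ * c i₀).trace.re := (hsmall i₀ hi₀k).symm
      _ ≤ ∑ i ∈ Finset.univ.filter (fun i => d i < k), (d i : ℝ) * (a i * b i * c i).trace.re :=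
          Finset.single_le_sum (f := fun i => (d i : ℝ) * (a i * b i * c i).trace.re)
            (fun i hi => by
              rw [hsmall i (Finset.mem_filter.1 hi).2]; positivity) hmem
  -- (4) blocks of dimension `≥ k`
  set K : ℝ := Real.sqrt (cG * A.card / k) with hK
  have hkpos : (0 : ℝ) < k := by exact_mod_cast hk
  have h4 : ∀ i, k ≤ d i → (d i : ℝ) * ‖(a i * b i * c i).trace‖ ≤
      K * (Real.sqrt (d i * ((b i)ᴴ * b i).trace.re) *
        Real.sqrt (d i * ((c i)ᴴ * c i).trace.re)) := by
    intro i hi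
    have hdi : (0 : ℝ) < d i := by exact_mod_cast (hk.trans hi)
    have hkle : (k : ℝ) ≤ d i := by exact_mod_cast hi
    have hai : ((a i)ᴴ * a i).trace.re ≤ cG * A.card / k := by
      have hle : (d i : ℝ) * ((a i)ᴴ * a i).trace.re ≤ cG * A.card := by
        rw [← h2A]
        exact Finset.single_le_sum (f := fun j => (d j : ℝ) * ((a j)ᴴ * a j).trace.re)
          (fun j _ => mul_nonneg (Nat.cast_nonneg _) (re_trace_conjTranspose_mul_self_nonneg _))
          (Finset.mem_univ i)
      calc ((a i)ᴴ * a i).trace.re ≤ cG * A.card / d i := by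
            rw [le_div_iff₀ hdi, mul_comm]; exact hle
        _ ≤ cG * A.card / k := div_le_div_of_nonneg_left (by positivity) hkpos hkle
    calc (d i : ℝ) * ‖(a i * b i * c i).trace‖
        ≤ d i * (Real.sqrt (((a i)ᴴ * a i).trace.re) *
            (Real.sqrt (((b i)ᴴ * b i).trace.re) * Real.sqrt (((c i)ᴴ * c i).trace.re))) :=
          mul_le_mul_of_nonneg_left (norm_trace_mul_mul_le _ _ _) hdi.le
      _ ≤ d i * (K * (Real.sqrt (((b i)ᴴ * b i).trace.re) *
            Real.sqrt (((c i)ᴴ * c i).trace.re))) := by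
          gcongr
          exact Real.sqrt_le_sqrt hai
      _ = K * (Real.sqrt (d i * ((b i)ᴴ * b i).trace.re) *
            Real.sqrt (d i * ((c i)ᴴ * c i).trace.re)) := by
          rw [Real.sqrt_mul hdi.le, Real.sqrt_mul hdi.le]
          have := Real.mul_self_sqrt hdi.le
          linear_combination
            (-(K * Real.sqrt (((b i)ᴴ * b i).trace.re) * Real.sqrt (((c i)ᴴ * c i).trace.re))) *
              this
  have h4sum : ∑ i ∈ Finset.univ.filter (fun i => ¬ d i < k),
      (d i : ℝ) * ‖(a i * b i * c i).trace‖ ≤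
        K * (Real.sqrt (cG * B.card) * Real.sqrt (cG * C.card)) := by
    calc ∑ i ∈ Finset.univ.filter (fun i => ¬ d i < k), (d i : ℝ) * ‖(a i * b i * c i).trace‖
        ≤ ∑ i ∈ Finset.univ.filter (fun i => ¬ d i < k),
            K * (Real.sqrt (d i * ((b i)ᴴ * b i).trace.re) *
              Real.sqrt (d i * ((c i)ᴴ * c i).trace.re)) :=
          Finset.sum_le_sum fun i hi => h4 i (not_lt.1 (Finset.mem_filter.1 hi).2)
      _ ≤ ∑ i, K * (Real.sqrt (d i * ((b i)ᴴ * b i).trace.re) *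
            Real.sqrt (d i * ((c i)ᴴ * c i).trace.re)) :=
          Finset.sum_le_univ_sum_of_nonneg fun i => by positivity
      _ = K * ∑ i, Real.sqrt (d i * ((b i)ᴴ * b i).trace.re) *
            Real.sqrt (d i * ((c i)ᴴ * c i).trace.re) := by rw [Finset.mul_sum]
      _ ≤ K * (Real.sqrt (∑ i, (d i : ℝ) * ((b i)ᴴ * b i).trace.re) *
            Real.sqrt (∑ i, (d i : ℝ) * ((c i)ᴴ * c i).trace.re)) := by
          gcongr
          exact Real.sum_sqrt_mul_sqrt_le _
            (fun i => mul_nonneg (Nat.cast_nonneg _) (re_trace_conjTranspose_mul_self_nonneg _))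
            (fun i => mul_nonneg (Nat.cast_nonneg _) (re_trace_conjTranspose_mul_self_nonneg _))
      _ = K * (Real.sqrt (cG * B.card) * Real.sqrt (cG * C.card)) := by rw [h2B, h2C]
  -- the error term is `(|G| P / k)^{1/2} · |G|`
  have hErr : K * (Real.sqrt (cG * B.card) * Real.sqrt (cG * C.card)) =
      cG * Real.sqrt (cG * P / k) := by
    have hx : 0 ≤ cG * A.card / k := by positivity
    have hy : (0 : ℝ) ≤ cG * B.card := by positivity
    rw [hK, ← Real.sqrt_mul hy, ← Real.sqrt_mul hx,
      show cG * A.card / k * (cG * B.card * (cG * C.card)) = cG ^ 2 * (cG * P / k) by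
        rw [hP]; ring,
      Real.sqrt_mul (by positivity), Real.sqrt_sq hGpos.le]
  -- (5) assemble
  have hsplit := Finset.sum_filter_add_sum_filter_not Finset.univ (fun i => d i < k)
    (fun i => (d i : ℝ) * (a i * b i * c i).trace.re)
  have hneg : -(K * (Real.sqrt (cG * B.card) * Real.sqrt (cG * C.card))) ≤
      ∑ i ∈ Finset.univ.filter (fun i => ¬ d i < k), (d i : ℝ) * (a i * b i * c i).trace.re := by
    refine (neg_le_neg h4sum).trans ?_
    rw [← Finset.sum_neg_distrib]
    refine Finset.sum_le_sum fun i _ => ?_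
    rw [← mul_neg]
    exact mul_le_mul_of_nonneg_left
      ((neg_le_neg (Complex.abs_re_le_norm _)).trans (neg_abs_le _)) (Nat.cast_nonneg _)
  have hmain : P - cG * Real.sqrt (cG * P / k) ≤ cG * N := by
    rw [h1, ← hsplit, ← hErr]
    linarith
  -- divide by `|G|`
  have : P / cG - Real.sqrt (cG * P / k) ≤ N := by
    rw [div_sub' (ne_of_gt hGpos), div_le_iff₀ hGpos]
    linarith
  simpa [hP, hcG, hN] using this

/-! ## The theorem -/

/-- **Gowers 2008, Theorem 3.3 under the (weaker) irreducible hypothesis**: if every irreducible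
representation of `Γ` of dimension `< k` (`k ≥ 1`) is trivial then (i) `|A||B||C| > |Γ|³/k`
forces a solution of `ab = c`, and (ii) `|A||B||C| ≥ |Γ|³/(η²k)` forces at least
`(1 − η)|A||B||C|/|Γ|` of them. [cite: Gowers2008, Thm. 3.3] -/
theorem product_mixing_of_irreducible (Γ : Type) [Group Γ] [Fintype Γ] [DecidableEq Γ] (k : ℕ)
    (hk : 1 ≤ k)
    (hq : ∀ (V : Type) [AddCommGroup V] [Module ℂ V] [FiniteDimensional ℂ V]
        (ρ : Representation ℂ Γ V), ρ.IsIrreducible → Module.finrank ℂ V < k →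
        ∀ g : Γ, ρ g = LinearMap.id)
    (A B C : Finset Γ) :
    ((Fintype.card Γ : ℝ) ^ 3 / k < (A.card : ℝ) * B.card * C.card →
        ∃ a ∈ A, ∃ b ∈ B, ∃ c ∈ C, a * b = c) ∧
      ∀ η : ℝ, 0 < η →
        (Fintype.card Γ : ℝ) ^ 3 / (η ^ 2 * k) ≤ (A.card : ℝ) * B.card * C.card →
        (1 - η) * ((A.card : ℝ) * B.card * C.card) / Fintype.card Γ ≤
          (((A ×ˢ B).filter fun p => p.1 * p.2 ∈ C).card : ℝ) := by
  classical
  have hcount := product_mixing_count Γ k hk hq A B C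
  set P : ℝ := (A.card : ℝ) * B.card * C.card with hP
  set N : ℕ := ((A ×ˢ B).filter fun p => p.1 * p.2 ∈ C).card with hN
  set n : ℝ := (Fintype.card Γ : ℝ) with hn
  have hnpos : (0 : ℝ) < n := by rw [hn]; exact_mod_cast Fintype.card_pos
  have hkpos : (0 : ℝ) < k := by exact_mod_cast hk
  have hP0 : 0 ≤ P := by rw [hP]; positivity
  refine ⟨fun hlt => ?_, fun η hη hge => ?_⟩
  · -- existence: `N > 0`
    have hPpos : 0 < P := lt_of_le_of_lt (by positivity) hlt
    have hsq : Real.sqrt (n * P / k) < P / n := by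
      rw [Real.sqrt_lt' (by positivity), div_pow, lt_div_iff₀ (by positivity),
        show n * P / k * n ^ 2 = n ^ 3 / k * P by ring]
      rw [sq]
      exact mul_lt_mul_of_pos_right hlt hPpos
    have hNpos : (0 : ℝ) < N := by linarith
    have hN1 : 0 < N := by exact_mod_cast hNpos
    obtain ⟨p, hp⟩ := Finset.card_pos.1 hN1
    rw [Finset.mem_filter, Finset.mem_product] at hp
    exact ⟨p.1, hp.1.1, p.2, hp.1.2, p.1 * p.2, hp.2, rfl⟩
  · -- counting
    have h1 : n ^ 3 ≤ η ^ 2 * k * P := by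
      have := hge
      rw [div_le_iff₀ (by positivity)] at this
      linarith
    have hsq : Real.sqrt (n * P / k) ≤ η * P / n := by
      rw [Real.sqrt_le_iff]
      refine ⟨by positivity, ?_⟩
      rw [div_pow, le_div_iff₀ (by positivity),
        show n * P / k * n ^ 2 = n ^ 3 * P / k by ring, div_le_iff₀ hkpos]
      calc n ^ 3 * P ≤ η ^ 2 * k * P * P := mul_le_mul_of_nonneg_right h1 hP0
        _ = (η * P) ^ 2 * k := by ring
    calc (1 - η) * P / n = P / n - η * P / n := by ring
      _ ≤ P / n - Real.sqrt (n * P / k) := by linarith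
      _ ≤ N := hcount

/-- **Gowers 2008, Theorem 3.3, proved** (from `product_mixing_of_irreducible`: the printed
hypothesis "no non-trivial representation of dimension less than `k`" implies the irreducible
one). [cite: Gowers2008, Thm. 3.3] -/
theorem Gowers2008_thm_3_3_holds : Gowers2008_thm_3_3 :=
  fun Γ _ _ _ k hk hq A B C =>
    product_mixing_of_irreducible Γ k hk (fun V _ _ _ ρ _ hlt => hq V ρ hlt) A B C

end Literature.GroupTheory.QuasirandomGroups

end
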